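import Summits.KontsevichZagierPeriods.KontsevichZagierPeriods.Theorems.BetaCancellation.Negative.LoadBearing

/-!
# `BetaCancellation` (stmt-KontsevichZagierPeriods-13633) — the linear Dirichlet chart (target `stub_dirichletLinear`), PROVED

cdisprove (refuter, gen 2) file for crux #4 `BetaCancellation` of route TerasomaMultiplication
(namespace `…BetaCancellationNegative`, companions `Negative/KernelForm.lean`, `Negative/LoadBearing.lean`).
Sorry-free, axioms ⊆ {propext, Classical.choice, Quot.sound}.

By-product of the disproof pass on the lead's line dirichlet-companion-to-pi (skeleton ce846a0b; no
kill): `dirichletLinear` — the chart `Ψ(t,x) = (x, (1−x)t)` of the open simplex by the open box,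
`|det DΨ| = 1 − x`, is ONE rule-(2) move:
`[simplex, x^{ℓ-1}y^{m-1}(1-x-y)^{-m}] ∼ [box, t^{m-1}(1-t)^{-m}x^{ℓ-1}]`. Vocabulary `box2`,
`simplex2` (semialgebraic, measurable). Pattern after `Theorems/MultiplicationThree/Negative/Pinned.lean`.
The polar chart is `Negative/DirichletPolar.lean`; cf. the drefute value certificates of
`Negative/DirichletCompanionStubs.lean` / `…Charts.lean` (summit-implied; pullback identities).
-/

noncomputable section

set_option linter.dupNamespace false

namespace Summit.KontsevichZagierPeriods.KontsevichZagierPeriods.BetaCancellationNegative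

open MeasureTheory Set
open Literature.NumberTheory.Transcendental
open Literature.NumberTheory.Transcendental.KZ
open Literature.ModelTheory.ExponentialFields (IsSemialgebraic isSemialgebraic_univ)
open MvPolynomial (aeval X C)
open Summit.KontsevichZagierPeriods.KontsevichZagierPeriods.Theses.TerasomaMultiplication
  (BetaCancellation)
open Literature.NumberTheory.Transcendental.KZreg (unitIoo isSemialgebraic_unitIoo volume_unitIoo)

/-! ## The linear Dirichlet chart (target `stub_dirichletLinear`) -/

section DirichletCharts

/-- The open unit box `(0,1)²`, in the stubs' spelling. [folklore] -/
def box2 : Set (Fin 2 → ℝ) := {z | z 0 ∈ Set.Ioo (0:ℝ) 1 ∧ z 1 ∈ Set.Ioo (0:ℝ) 1}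

/-- The open standard simplex `{x > 0, y > 0, x + y < 1}`, in the stubs' spelling. [folklore] -/
def simplex2 : Set (Fin 2 → ℝ) := {z | 0 < z 0 ∧ 0 < z 1 ∧ z 0 + z 1 < 1}

/-- The box is the open unit box `{x | ∀ i, x i ∈ (0,1)}`. [folklore] -/
theorem box2_eq : box2 = {x : Fin 2 → ℝ | ∀ j, x j ∈ Set.Ioo (0:ℝ) 1} := by
  ext x
  simp only [box2, mem_setOf_eq, Fin.forall_fin_two]

/-- The describing polynomials of the simplex. [folklore] -/
def simplexPolys : Fin 3 → MvPolynomial (Fin 2) ℚ := ![X 0, X 1, 1 - X 0 - X 1]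

/-- The simplex is cut out by `simplexPolys > 0`. [folklore] -/
theorem simplex2_eq : simplex2 = {x | ∀ l, 0 < aeval x (simplexPolys l)} := by
  ext x
  simp only [simplex2, mem_setOf_eq, Fin.forall_fin_succ, simplexPolys, Matrix.cons_val_zero,
    Matrix.cons_val_succ, map_sub, map_one, MvPolynomial.aeval_X]
  constructor
  · rintro ⟨h0, h1, h2⟩; exact ⟨h0, h1, by linarith, fun i => Fin.elim0 i⟩
  · rintro ⟨h0, h1, h2, -⟩; exact ⟨h0, h1, by linarith⟩

/-- The box is `ℚ`-semialgebraic. [folklore] -/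
theorem isSemialgebraic_box2 : IsSemialgebraic ℚ box2 := by
  rw [box2_eq]; exact KZ.isSemialgebraic_box 2

/-- The simplex is `ℚ`-semialgebraic. [folklore] -/
theorem isSemialgebraic_simplex2 : IsSemialgebraic ℚ simplex2 := by
  rw [simplex2_eq]; exact isSemialgebraic_setOf_forall_aeval_pos _

/-- The box is measurable. [folklore] -/
theorem measurableSet_box2 : MeasurableSet box2 :=
  Literature.ModelTheory.ExponentialFields.IsSemialgebraic.measurableSet_holds isSemialgebraic_box2

/-! ### The linear chart `Ψ(t,x) = (x, (1-x)t)` of the simplex by the box -/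

/-- The linear chart `Ψ(t, x) = (x, (1 - x)t)` (affine in each fibre). [folklore] -/
def Ψ (z : Fin 2 → ℝ) : Fin 2 → ℝ := ![z 1, (1 - z 1) * z 0]

/-- First component. [folklore] -/
@[simp] theorem Ψ_apply_zero (z : Fin 2 → ℝ) : Ψ z 0 = z 1 := rfl

/-- Second component. [folklore] -/
@[simp] theorem Ψ_apply_one (z : Fin 2 → ℝ) : Ψ z 1 = (1 - z 1) * z 0 := rfl

/-- The Jacobian matrix of `Ψ`. [folklore] -/
def jacΨ (z : Fin 2 → ℝ) : Matrix (Fin 2) (Fin 2) ℝ := !![0, 1; 1 - z 1, -(z 0)]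

/-- The derivative of `Ψ`. [folklore] -/
def Ψ' (z : Fin 2 → ℝ) : (Fin 2 → ℝ) →L[ℝ] (Fin 2 → ℝ) :=
  LinearMap.toContinuousLinearMap (Matrix.toLin' (jacΨ z))

/-- The derivative applied to a vector, first component. [folklore] -/
@[simp] theorem Ψ'_apply_zero (z v : Fin 2 → ℝ) : Ψ' z v 0 = v 1 := by
  change Matrix.toLin' (jacΨ z) v 0 = _
  rw [Matrix.toLin'_apply]
  simp [jacΨ, Matrix.mulVec, dotProduct, Fin.sum_univ_two]

/-- The derivative applied to a vector, second component. [folklore] -/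
@[simp] theorem Ψ'_apply_one (z v : Fin 2 → ℝ) : Ψ' z v 1 = (1 - z 1) * v 0 + -(z 0) * v 1 := by
  change Matrix.toLin' (jacΨ z) v 1 = _
  rw [Matrix.toLin'_apply]
  simp [jacΨ, Matrix.mulVec, dotProduct, Fin.sum_univ_two]

/-- `det DΨ = -(1 - x)`. [folklore] -/
theorem det_Ψ' (z : Fin 2 → ℝ) : (Ψ' z).det = -(1 - z 1) := by
  change LinearMap.det (Matrix.toLin' (jacΨ z)) = _
  rw [LinearMap.det_toLin', Matrix.det_fin_two]
  simp [jacΨ]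

/-- `|det DΨ| = 1 - x` on the box. [folklore] -/
theorem abs_det_Ψ' {z : Fin 2 → ℝ} (hz : z ∈ box2) : |(Ψ' z).det| = 1 - z 1 := by
  rw [det_Ψ', abs_neg, abs_of_pos (sub_pos.2 hz.2.2)]

/-- `Ψ` is differentiable with derivative `Ψ'`. [folklore] -/
theorem hasFDerivAt_Ψ (z : Fin 2 → ℝ) : HasFDerivAt Ψ (Ψ' z) z := by
  have h0 : HasFDerivAt (fun y : Fin 2 → ℝ => y 0)
      (ContinuousLinearMap.proj (R := ℝ) (φ := fun _ : Fin 2 => ℝ) 0) z := hasFDerivAt_apply 0 z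
  have h1 : HasFDerivAt (fun y : Fin 2 → ℝ => y 1)
      (ContinuousLinearMap.proj (R := ℝ) (φ := fun _ : Fin 2 => ℝ) 1) z := hasFDerivAt_apply 1 z
  rw [hasFDerivAt_pi']
  refine Fin.forall_fin_two.mpr ⟨?_, ?_⟩
  · have hf : (fun y : Fin 2 → ℝ => Ψ y 0) = fun y => y 1 := funext fun y => rfl
    rw [hf]
    refine h1.congr_fderiv (ContinuousLinearMap.ext fun v => ?_)
    simp
  · have hf : (fun y : Fin 2 → ℝ => Ψ y 1) = fun y => (1 - y 1) * y 0 := funext fun y => rfl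
    rw [hf]
    refine ((h1.const_sub 1).mul h0).congr_fderiv (ContinuousLinearMap.ext fun v => ?_)
    simp

/-- `Ψ` is injective on the box. [folklore] -/
theorem injOn_Ψ : InjOn Ψ box2 := by
  intro x hx y hy hxy
  have h1 : x 1 = y 1 := by
    have := congrFun hxy 0
    simpa using this
  have h0 : x 0 = y 0 := by
    have := congrFun hxy 1
    simp only [Ψ_apply_one, h1] at this
    have hne : (1 - y 1 : ℝ) ≠ 0 := (sub_pos.2 hy.2.2).ne'
    exact mul_left_cancel₀ hne this
  funext i
  fin_cases i
  · exact h0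
  · exact h1

/-- `Ψ` maps the box ONTO the simplex. [folklore] -/
theorem image_Ψ_box2 : Ψ '' box2 = simplex2 := by
  ext y
  constructor
  · rintro ⟨z, ⟨h0, h1⟩, rfl⟩
    refine ⟨by simpa using h1.1, by simpa using mul_pos (sub_pos.2 h1.2) h0.1, ?_⟩
    simp only [Ψ_apply_zero, Ψ_apply_one]
    nlinarith [h0.2, sub_pos.2 h1.2]
  · rintro ⟨hy0, hy1, hy2⟩
    have h3 : 0 < 1 - y 0 := by linarith
    refine ⟨![y 1 / (1 - y 0), y 0], ⟨?_, ?_⟩, ?_⟩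
    · change y 1 / (1 - y 0) ∈ Ioo (0:ℝ) 1
      exact ⟨div_pos hy1 h3, by rw [div_lt_one h3]; linarith⟩
    · change y 0 ∈ Ioo (0:ℝ) 1
      exact ⟨hy0, by linarith⟩
    · funext i
      fin_cases i
      · rfl
      · change (1 - y 0) * (y 1 / (1 - y 0)) = y 1
        field_simp

/-- The substitution polynomials of `Ψ`. [folklore] -/
def substΨ : Fin 2 → MvPolynomial (Fin 2) ℚ := ![X 1, (1 - X 1) * X 0]

/-- Evaluating the substitution is the chart. [folklore] -/
theorem aeval_substΨ (z : Fin 2 → ℝ) : (fun i => aeval z (substΨ i)) = Ψ z := by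
  funext i
  fin_cases i
  · simp [substΨ]
  · simp [substΨ]

/-- `Ψ` is a `ℚ`-semialgebraic map on the box (a polynomial map). [folklore] -/
theorem isSemialgebraicMapOn_Ψ : IsSemialgebraicMapOn ℚ box2 Ψ := by
  convert isSemialgebraicMapOn_aeval isSemialgebraic_box2 substΨ using 2 with z
  exact (aeval_substΨ z).symm

/-- **The pull-back identity of the linear chart**: on the box,
`(x^{ℓ-1} y^{m-1} (1-x-y)^{-m}) ∘ Ψ · |det DΨ| = t^{m-1}(1-t)^{-m} x^{ℓ-1}`. [folklore] -/
theorem pullback_Ψ (ℓ m : ℚ) {z : Fin 2 → ℝ} (hz : z ∈ box2) :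
    (Ψ z 0) ^ ((ℓ:ℝ) - 1) * (Ψ z 1) ^ ((m:ℝ) - 1) * (1 - Ψ z 0 - Ψ z 1) ^ (-(m:ℝ)) * |(Ψ' z).det| =
      (z 0) ^ ((m:ℝ) - 1) * (1 - z 0) ^ (-(m:ℝ)) * (z 1) ^ ((ℓ:ℝ) - 1) := by
  have ht0 : 0 < z 0 := hz.1.1
  have ht1 : 0 < 1 - z 0 := sub_pos.2 hz.1.2
  have hx1 : 0 < 1 - z 1 := sub_pos.2 hz.2.2
  rw [abs_det_Ψ' hz]
  simp only [Ψ_apply_zero, Ψ_apply_one]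
  have hfac : 1 - z 1 - (1 - z 1) * z 0 = (1 - z 1) * (1 - z 0) := by ring
  rw [hfac, Real.mul_rpow hx1.le ht0.le, Real.mul_rpow hx1.le ht1.le]
  have key : (1 - z 1) ^ ((m:ℝ) - 1) * (1 - z 1) ^ (-(m:ℝ)) * (1 - z 1) = 1 := by
    rw [← Real.rpow_add hx1, show (m:ℝ) - 1 + -(m:ℝ) = -1 by ring, Real.rpow_neg_one,
      inv_mul_cancel₀ hx1.ne']
  calc (z 1) ^ ((ℓ:ℝ) - 1) * ((1 - z 1) ^ ((m:ℝ) - 1) * (z 0) ^ ((m:ℝ) - 1)) *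
        ((1 - z 1) ^ (-(m:ℝ)) * (1 - z 0) ^ (-(m:ℝ))) * (1 - z 1)
      = (z 0) ^ ((m:ℝ) - 1) * (1 - z 0) ^ (-(m:ℝ)) * (z 1) ^ ((ℓ:ℝ) - 1) *
          ((1 - z 1) ^ ((m:ℝ) - 1) * (1 - z 1) ^ (-(m:ℝ)) * (1 - z 1)) := by ring
    _ = (z 0) ^ ((m:ℝ) - 1) * (1 - z 0) ^ (-(m:ℝ)) * (z 1) ^ ((ℓ:ℝ) - 1) := by rw [key, mul_one]

/-- **The lead's `stub_dirichletLinear`, PROVED**: the linear chart is ONE rule-(2) move,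
`[simplex, x^{ℓ-1} y^{m-1} (1-x-y)^{-m}] ∼ [box, t^{m-1}(1-t)^{-m} x^{ℓ-1}]`. [folklore] -/
theorem dirichletLinear (ℓ m : ℚ) (hℓ : 0 < ℓ) (hm : 0 < m) (hm1 : m < 1)
    (S B : IntegralRep 2)
    (hSd : S.domain = {z | 0 < z 0 ∧ 0 < z 1 ∧ z 0 + z 1 < 1})
    (hSi : Set.EqOn S.integrand (fun z => (z 0) ^ ((ℓ:ℝ) - 1) * (z 1) ^ ((m:ℝ) - 1) *
      (1 - z 0 - z 1) ^ (-(m:ℝ))) S.domain)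
    (hBd : B.domain = {z | z 0 ∈ Set.Ioo (0:ℝ) 1 ∧ z 1 ∈ Set.Ioo (0:ℝ) 1})
    (hBi : Set.EqOn B.integrand (fun z => (z 0) ^ ((m:ℝ) - 1) * (1 - z 0) ^ (-(m:ℝ)) *
      (z 1) ^ ((ℓ:ℝ) - 1)) B.domain) :
    Equivalent S B := by
  have _hℓ := hℓ; have _hm := hm; have _hm1 := hm1
  have hBd' : B.domain = box2 := hBd
  have hSd' : S.domain = simplex2 := hSd
  have hmem : of B - of S ∈ changeOfVariablesRel := by
    refine ⟨2, B, S, Ψ, Ψ', by rw [hBd']; exact isSemialgebraicMapOn_Ψ,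
      fun x _ => (hasFDerivAt_Ψ x).hasFDerivWithinAt, by rw [hBd']; exact injOn_Ψ,
      by rw [hBd', hSd', image_Ψ_box2], fun z hz => ?_, rfl⟩
    have hz' : z ∈ box2 := by rw [hBd'] at hz; exact hz
    have hΨz : Ψ z ∈ S.domain := by
      rw [hSd', ← image_Ψ_box2]
      exact mem_image_of_mem Ψ hz'
    rw [hBi hz, hSi hΨz]
    show (z 0) ^ ((m:ℝ) - 1) * (1 - z 0) ^ (-(m:ℝ)) * (z 1) ^ ((ℓ:ℝ) - 1) =
      (Ψ z 0) ^ ((ℓ:ℝ) - 1) * (Ψ z 1) ^ ((m:ℝ) - 1) * (1 - Ψ z 0 - Ψ z 1) ^ (-(m:ℝ)) * |(Ψ' z).det|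
    rw [pullback_Ψ ℓ m hz']
  exact Equivalent.symm (changeOfVariablesRel_subset_relations hmem)

end DirichletCharts

end Summit.KontsevichZagierPeriods.KontsevichZagierPeriods.BetaCancellationNegative
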